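import Literature.NumberTheory.Automorphic.HeckeFixedVectorsSimple
import Mathlib.LinearAlgebra.FiniteDimensional.Basic
import Mathlib.LinearAlgebra.Dimension.Constructions
import HarnessLib

/-!
# Local lemmas for Flath's tensor product theorem: fixed vectors of a commuting factor

Topic `NumberTheory/Automorphic`; theorems only (no definition, no named fact). This is the first,
purely algebraic, layer of the proof of the existence half of **Flath's theorem**
(`Literature.NumberTheory.Automorphic.flath_exists` in `AutomorphicGLn`: an irreducible admissible
representation of a restricted product `Πʳ (G i, K i)` is a restricted tensor product of
irreducible admissible representations; Flath, *Decomposition of representations into tensor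
products*, Corvallis 1979, Thm. 3 with Thm. 2 and Example 2; Bump, *Automorphic forms and
representations* (1997), §3.4, Thm. 3.4.2, Prop. 3.4.9, Thm. 3.4.4).

The printed proofs factor an irreducible admissible module over a tensor product of idempotented
(Hecke) algebras through Burnside's theorem and direct limits (Bump, pp. 301–315). The tree proves
the theorem *inside* the given representation `π` of `Γ = Πʳ (G i, K i)`: the local factor at `i` is
the cyclic `G i`-module `span {π(ι_i g) w⋆}` of a suitably chosen ("purified") vector `w⋆`, where
`ι_i : G i →* Γ` is the coordinate embedding. What makes this work is that every `γ ∈ Γ` factors as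
`γ = c · ι_i(a)` with `c` commuting with `ι_i(G i)`. The present file isolates the three statements
about an abstract group homomorphism `φ : H →* Γ` with this factorisation property
(hypothesis `hφ`) and a representation `π` of `Γ` on `W`:

* `fixedPoints_comp_eq_bot_of_inf_eq_bot` (**dichotomy**): if `π` is irreducible, `L ≤ H` meets
  every stabiliser of `π ∘ φ` with finite index (e.g. `L` compact, `π ∘ φ` smooth), and some
  non-zero `φ(H)`-stable subspace `Z` contains no non-zero `φ(L)`-fixed vector, then `W` has no
  non-zero `φ(L)`-fixed vector at all. (Write a fixed `w` as `∑ π(γ_t) z_t`, `γ_t = c_t φ(a_t)`,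
  and average over `L`: the `L`-average of `φ(a_t) z_t` is an `L`-fixed vector of `Z`.)
  Contrapositively: once `W^{φ(L)} ≠ 0`, every non-zero `φ(H)`-stable subspace meets `W^{φ(L)}`
  (`inf_fixedPoints_ne_bot_of_stable`).
* `exists_irreducible_stable_le` (**an irreducible stable subspace with fixed vectors**): if the
  `φ(L)`-fixed vectors of a stable `Z` are finite-dimensional and non-zero and the dichotomy holds
  below `Z`, then `Z` contains an *irreducible* `φ(H)`-stable subspace with a non-zero `φ(L)`-fixed
  vector: minimise `dim (Y ∩ W^{φ(L)})` and take the span of the translates of `Y ∩ W^{φ(L)}`.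
* `map_stable_irreducible_of_comm` (**images**): the image of an irreducible stable subspace under
  an endomorphism commuting with `φ(H)` is stable and irreducible or zero.

These replace, for the existence half of Flath's theorem, the passage through simple modules over
`H₁ ⊗ H₂` (Bump, Prop. 3.4.1–3.4.2): see `FlathBaseVector` and `AutomorphicGLnFlathProofs`.
"Stable"/"irreducible" are spelled out on `Submodule`s (`∀ h, ∀ z ∈ Z, π (φ h) z ∈ Z`; every stable
`X ≤ V` is `⊥` or `V`) because the subspaces live in the ambient `W`, not in a representation of
`H` of their own; the translation to Mathlib's `Representation.IsIrreducible` of the restricted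
representation is made where it is used.

## References

* D. Flath, *Decomposition of representations into tensor products*, Proc. Sympos. Pure Math. 33
  (1979), part 1, 179–183, Thm. 2–3 [FlathCorvallis1979].
* D. Bump, *Automorphic forms and representations*, Cambridge Stud. Adv. Math. 55 (1997), §3.4
  (pp. 301–315) and Prop. 4.2.3 (p. 427: `V^K` and the averaging over `K`) [Bump1997].
-/

noncomputable section

open MulAction

namespace Literature.NumberTheory.Automorphic

/-! ### The dichotomy: a stable subspace without fixed vectors kills all fixed vectors -/

section Dichotomy

variable {k Γ H W : Type*} [Field k] [Group Γ] [Group H] [AddCommGroup W] [Module k W]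
  (π : Representation k Γ W) (φ : H →* Γ) (L : Subgroup H)

/-- The span of the `Γ`-translates of a subspace `Z` is a subrepresentation; if `π` is
irreducible and `Z ≠ 0` it is everything. [folklore] -/
theorem span_iUnion_image_eq_top [π.IsIrreducible] {Z : Submodule k W} (hZ0 : Z ≠ ⊥) :
    Submodule.span k (⋃ γ : Γ, π γ '' (Z : Set W)) = ⊤ := by
  set S : Set W := ⋃ γ : Γ, π γ '' (Z : Set W) with hS
  have hSsub : ∀ γ : Γ, π γ '' S ⊆ S := by
    rintro γ _ ⟨x, hx, rfl⟩
    obtain ⟨γ', hxγ⟩ := Set.mem_iUnion.1 hx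
    obtain ⟨z, hz, rfl⟩ := hxγ
    refine Set.mem_iUnion.2 ⟨γ * γ', z, hz, ?_⟩
    rw [map_mul, Module.End.mul_apply]
  obtain ⟨U, hU⟩ : ∃ U : Subrepresentation π, U.toSubmodule = Submodule.span k S :=
    ⟨⟨Submodule.span k S, fun γ x hx => by
        have h := Submodule.mem_map_of_mem (f := π γ) hx
        rw [Submodule.map_span] at h
        exact Submodule.span_mono (hSsub γ) h⟩, rfl⟩
  obtain ⟨z₀, hz₀, hz₀0⟩ := (Submodule.ne_bot_iff Z).1 hZ0
  have hz₀S : z₀ ∈ S := Set.mem_iUnion.2 ⟨1, z₀, hz₀, by rw [map_one, Module.End.one_apply]⟩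
  have hUbot : U ≠ ⊥ := by
    intro h
    have hmem : z₀ ∈ U.toSubmodule := hU ▸ Submodule.subset_span hz₀S
    rw [h] at hmem
    exact hz₀0 ((Submodule.mem_bot k).1 hmem)
  have hUtop : U = ⊤ := (IsSimpleOrder.eq_bot_or_eq_top U).resolve_left hUbot
  rw [← hU, hUtop]
  rfl

/-- **Dichotomy lemma.** Let `π` be an irreducible representation of `Γ` over a field of
characteristic zero and `φ : H →* Γ` a homomorphism such that every `γ ∈ Γ` factors as
`γ = c · φ(a)` with `c` commuting with `φ(H)` (hypothesis `hφ`; e.g. a coordinate embedding into a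
restricted product). Let `L ≤ H` be a subgroup meeting the stabiliser of every vector (for
`π ∘ φ`) in a finite-index subgroup of `L` (hypothesis `hL`; e.g. `L` compact and `π ∘ φ` smooth).
If a non-zero `φ(H)`-stable subspace `Z` contains no non-zero `φ(L)`-fixed vector, then `W` has no
non-zero `φ(L)`-fixed vector. Proof: a fixed `w` lies in the span of the `π(γ) Z` (irreducibility);
write the generators as `π(c) π(φ a) z` and sum over `L ⧸ A` for a small finite-index `A`: the
coset sum of `π(φ a) z ∈ Z` over `L ⧸ A` is an `L`-fixed vector of `Z`, hence `0`, and `π(c)`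
commutes with it; so all coset sums of `w` vanish, while the one over `L ⧸ B` is `[L:B] • w`.
(The averaging argument of Bump (1997), Prop. 4.2.3, p. 427, for the factor `φ(H)` of `Γ`.) [folklore] -/
theorem fixedPoints_comp_eq_bot_of_inf_eq_bot [CharZero k] [π.IsIrreducible]
    (hφ : ∀ γ : Γ, ∃ c : Γ, ∃ a : H, γ = c * φ a ∧ ∀ h : H, c * φ h = φ h * c)
    (hL : ∀ v : W, ((Representation.stabilizerSubgroup (π.comp φ) v).subgroupOf L).FiniteIndex)
    {Z : Submodule k W} (hZ : ∀ h : H, ∀ z ∈ Z, π (φ h) z ∈ Z) (hZ0 : Z ≠ ⊥)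
    (hZL : Z ⊓ Representation.fixedPoints (π.comp φ) L = ⊥) :
    Representation.fixedPoints (π.comp φ) L = ⊥ := by
  classical
  set σ : Representation k H W := π.comp φ with hσ
  rw [Submodule.eq_bot_iff]
  intro w hw
  have hwS : w ∈ Submodule.span k (⋃ γ : Γ, π γ '' (Z : Set W)) := by
    rw [span_iUnion_image_eq_top π hZ0]
    exact Submodule.mem_top
  -- every vector of the span is fixed by a finite-index `B ≤ L`, with vanishing coset sums
  have key : ∀ u ∈ Submodule.span k (⋃ γ : Γ, π γ '' (Z : Set W)),
      ∃ B : Subgroup L, B.FiniteIndex ∧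
        u ∈ Representation.fixedPoints (σ.comp L.subtype) B ∧
        ∀ A : Subgroup L, A ≤ B → A.FiniteIndex →
          ∑ᶠ c : L ⧸ A, (σ.comp L.subtype) c.out u = 0 := by
    intro u hu
    induction hu using Submodule.span_induction with
    | mem x hx =>
      obtain ⟨γ, hxγ⟩ := Set.mem_iUnion.1 hx
      obtain ⟨z, hz, rfl⟩ := hxγ
      obtain ⟨c, a, rfl, hc⟩ := hφ γ
      have hz' : π (φ a) z ∈ Z := hZ a z hz
      have hx' : π (c * φ a) z = π c (π (φ a) z) := by rw [map_mul, Module.End.mul_apply]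
      -- `π c` commutes with `π (φ h)`
      have hcomm : ∀ (h : H) (v : W), π (φ h) (π c v) = π c (π (φ h) v) := fun h v => by
        rw [← Module.End.mul_apply, ← map_mul, ← hc h, map_mul, Module.End.mul_apply]
      refine ⟨(σ.stabilizerSubgroup (π (φ a) z)).subgroupOf L, hL _, ?_, fun A hA hAfi => ?_⟩
      · rw [Representation.mem_fixedPoints]
        rintro ⟨b, hbL⟩ hb
        rw [Subgroup.mem_subgroupOf, Representation.mem_stabilizerSubgroup] at hb
        change π (φ b) (π (c * φ a) z) = π (c * φ a) z
        rw [hx', hcomm]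
        exact congrArg (π c) hb
      · haveI := hAfi
        letI : Fintype (L ⧸ A) := Fintype.ofFinite _
        have hsum : ∑ᶠ c' : L ⧸ A, (σ.comp L.subtype) c'.out (π (c * φ a) z) =
            π c (∑ᶠ c' : L ⧸ A, (σ.comp L.subtype) c'.out (π (φ a) z)) := by
          rw [finsum_eq_sum_of_fintype, finsum_eq_sum_of_fintype, map_sum]
          refine Finset.sum_congr rfl fun c' _ => ?_
          change π (φ (c'.out : L)) (π (c * φ a) z) = π c (π (φ (c'.out : L)) (π (φ a) z))
          rw [hx', hcomm]
        have hzA : π (φ a) z ∈ Representation.fixedPoints (σ.comp L.subtype) A := by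
          refine Representation.fixedPoints_antitone _ hA ?_
          rw [Representation.mem_fixedPoints]
          rintro ⟨b, hbL⟩ hb
          rw [Subgroup.mem_subgroupOf, Representation.mem_stabilizerSubgroup] at hb
          exact hb
        have hmem : ∑ᶠ c' : L ⧸ A, (σ.comp L.subtype) c'.out (π (φ a) z) ∈
            Z ⊓ σ.fixedPoints L := by
          refine Submodule.mem_inf.2 ⟨?_, finsum_apply_out_mem_invariants (σ.comp L.subtype) A hzA⟩
          rw [finsum_eq_sum_of_fintype]
          exact Z.sum_mem fun c' _ => hZ _ _ hz'
        rw [hZL, Submodule.mem_bot] at hmem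
        rw [hsum, hmem, map_zero]
    | zero =>
      refine ⟨⊤, inferInstance, Submodule.zero_mem _, fun A _ _ => ?_⟩
      simp only [map_zero, finsum_zero]
    | add x y _ _ ihx ihy =>
      obtain ⟨B₁, hB₁, hx₁, h₁⟩ := ihx
      obtain ⟨B₂, hB₂, hy₂, h₂⟩ := ihy
      refine ⟨B₁ ⊓ B₂, ⟨Subgroup.index_inf_ne_zero hB₁.index_ne_zero hB₂.index_ne_zero⟩,
        Submodule.add_mem _
          (Representation.fixedPoints_antitone (σ.comp L.subtype) inf_le_left hx₁)
          (Representation.fixedPoints_antitone (σ.comp L.subtype) inf_le_right hy₂),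
        fun A hA hAfi => ?_⟩
      haveI := hAfi
      letI : Fintype (L ⧸ A) := Fintype.ofFinite _
      have hx' := h₁ A (hA.trans inf_le_left) hAfi
      have hy' := h₂ A (hA.trans inf_le_right) hAfi
      rw [finsum_eq_sum_of_fintype] at hx' hy' ⊢
      simp only [map_add, Finset.sum_add_distrib, hx', hy', add_zero]
    | smul a x _ ih =>
      obtain ⟨B, hB, hxB, h⟩ := ih
      refine ⟨B, hB, Submodule.smul_mem _ a hxB, fun A hA hAfi => ?_⟩
      haveI := hAfi
      letI : Fintype (L ⧸ A) := Fintype.ofFinite _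
      have hx' := h A hA hAfi
      rw [finsum_eq_sum_of_fintype] at hx' ⊢
      simp only [map_smul, ← Finset.smul_sum, hx', smul_zero]
  obtain ⟨B, hBfi, -, hB⟩ := key w hwS
  have hwinv : w ∈ Representation.invariants (σ.comp L.subtype) := hw
  have h0 := hB B le_rfl hBfi
  rw [finsum_apply_out_eq_index_smul (σ.comp L.subtype) B hwinv, ← Nat.cast_smul_eq_nsmul k]
    at h0
  exact (smul_eq_zero.1 h0).resolve_left (Nat.cast_ne_zero.2 hBfi.index_ne_zero)

/-- **Dichotomy, contrapositive form.** Under the hypotheses of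
`fixedPoints_comp_eq_bot_of_inf_eq_bot`, if `W` has a non-zero `φ(L)`-fixed vector then every
non-zero `φ(H)`-stable subspace `Z` contains one. [folklore] -/
theorem inf_fixedPoints_ne_bot_of_stable [CharZero k] [π.IsIrreducible]
    (hφ : ∀ γ : Γ, ∃ c : Γ, ∃ a : H, γ = c * φ a ∧ ∀ h : H, c * φ h = φ h * c)
    (hL : ∀ v : W, ((Representation.stabilizerSubgroup (π.comp φ) v).subgroupOf L).FiniteIndex)
    (hW : Representation.fixedPoints (π.comp φ) L ≠ ⊥)
    {Z : Submodule k W} (hZ : ∀ h : H, ∀ z ∈ Z, π (φ h) z ∈ Z) (hZ0 : Z ≠ ⊥) :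
    Z ⊓ Representation.fixedPoints (π.comp φ) L ≠ ⊥ := fun h =>
  hW (fixedPoints_comp_eq_bot_of_inf_eq_bot π φ L hφ hL hZ hZ0 h)

end Dichotomy

/-! ### An irreducible stable subspace with fixed vectors -/

section Irreducible

variable {k H W : Type*} [Field k] [Group H] [AddCommGroup W] [Module k W]
  (σ : Representation k H W)

/-- The span of the `H`-translates of a subset is `H`-stable. [folklore] -/
theorem apply_mem_span_iUnion_image (T : Set W) (h : H) {v : W}
    (hv : v ∈ Submodule.span k (⋃ h : H, σ h '' T)) :
    σ h v ∈ Submodule.span k (⋃ h : H, σ h '' T) := by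
  have hsub : σ h '' (⋃ h' : H, σ h' '' T) ⊆ ⋃ h' : H, σ h' '' T := by
    rintro _ ⟨x, hx, rfl⟩
    obtain ⟨h', hxh⟩ := Set.mem_iUnion.1 hx
    obtain ⟨t, ht, rfl⟩ := hxh
    refine Set.mem_iUnion.2 ⟨h * h', t, ht, ?_⟩
    rw [map_mul, Module.End.mul_apply]
  have hm := Submodule.mem_map_of_mem (f := σ h) hv
  rw [Submodule.map_span] at hm
  exact Submodule.span_mono hsub hm

/-- The span of the `H`-translates of a subset of an `H`-stable subspace `Y` lies in `Y`. [folklore] -/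
theorem span_iUnion_image_le {Y : Submodule k W} (hY : ∀ h : H, ∀ y ∈ Y, σ h y ∈ Y)
    {T : Set W} (hT : T ⊆ Y) : Submodule.span k (⋃ h : H, σ h '' T) ≤ Y := by
  rw [Submodule.span_le]
  intro x hx
  obtain ⟨h, hxh⟩ := Set.mem_iUnion.1 hx
  obtain ⟨t, ht, rfl⟩ := hxh
  exact hY h t (hT ht)

/-- A subset lies in the span of its `H`-translates. [folklore] -/
theorem subset_span_iUnion_image (T : Set W) : T ⊆ Submodule.span k (⋃ h : H, σ h '' T) :=
  fun t ht => Submodule.subset_span (Set.mem_iUnion.2 ⟨1, t, ht, by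
    rw [map_one, Module.End.one_apply]⟩)

/-- **An irreducible stable subspace with fixed vectors.** Let `σ` be a representation of `H` on
`W`, `F ≤ W` a subspace (in the application: the vectors fixed by a compact open subgroup) and `Z`
an `H`-stable subspace such that `Z ∩ F` is finite-dimensional and non-zero, and such that every
non-zero `H`-stable `Y ≤ Z` meets `F` non-trivially (the dichotomy
`inf_fixedPoints_ne_bot_of_stable`). Then `Z` contains an `H`-stable subspace `V` with
`V ∩ F ≠ 0` which is irreducible: its only `H`-stable subspaces are `⊥` and `V`. Proof: choose a
stable `Y ≤ Z` with `Y ∩ F ≠ 0` of minimal dimension and let `V` be the span of the translates of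
`Y ∩ F`; a non-zero stable `X ≤ V` has `0 ≠ X ∩ F ≤ Y ∩ F`, equality by minimality, so `X ⊇ V`.
(This is the finite-dimensional reduction "any non-zero `A`-module of minimal dimension is simple"
of Bump (1997), proof of Prop. 3.4.1, p. 302, transported to `W` through the fixed vectors.) [folklore] -/
theorem exists_irreducible_stable_le (F Z : Submodule k W)
    (hZ : ∀ h : H, ∀ z ∈ Z, σ h z ∈ Z) [Module.Finite k ↥(Z ⊓ F)] (hZF : Z ⊓ F ≠ ⊥)
    (hdich : ∀ Y : Submodule k W, Y ≤ Z → (∀ h : H, ∀ y ∈ Y, σ h y ∈ Y) → Y ≠ ⊥ → Y ⊓ F ≠ ⊥) :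
    ∃ V : Submodule k W, V ≤ Z ∧ (∀ h : H, ∀ v ∈ V, σ h v ∈ V) ∧ V ⊓ F ≠ ⊥ ∧
      ∀ X : Submodule k W, X ≤ V → (∀ h : H, ∀ x ∈ X, σ h x ∈ X) → X = ⊥ ∨ X = V := by
  classical
  let P : ℕ → Prop := fun n => ∃ Y : Submodule k W, Y ≤ Z ∧ (∀ h : H, ∀ y ∈ Y, σ h y ∈ Y) ∧
    Y ⊓ F ≠ ⊥ ∧ Module.finrank k ↥(Y ⊓ F) = n
  have hP : ∃ n, P n := ⟨_, Z, le_rfl, hZ, hZF, rfl⟩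
  obtain ⟨Y, hYZ, hY, hYF, hYn⟩ := Nat.find_spec hP
  haveI hYfin : Module.Finite k ↥(Y ⊓ F) :=
    Submodule.finiteDimensional_of_le (inf_le_inf_right F hYZ)
  -- `V` := span of the translates of `Y ⊓ F`
  set T : Set W := ((Y ⊓ F : Submodule k W) : Set W) with hT
  refine ⟨Submodule.span k (⋃ h : H, σ h '' T), ?_, fun h v hv => apply_mem_span_iUnion_image σ T h hv,
    ?_, fun X hXV hX => ?_⟩
  · exact (span_iUnion_image_le σ hY (T := T) fun x hx => (Submodule.mem_inf.1 hx).1).trans hYZ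
  · intro hbot
    apply hYF
    rw [eq_bot_iff]
    intro x hx
    have hxV : x ∈ Submodule.span k (⋃ h : H, σ h '' T) := subset_span_iUnion_image σ T hx
    have : x ∈ Submodule.span k (⋃ h : H, σ h '' T) ⊓ F :=
      Submodule.mem_inf.2 ⟨hxV, (Submodule.mem_inf.1 hx).2⟩
    rw [hbot] at this
    exact this
  · by_cases hX0 : X = ⊥
    · exact Or.inl hX0
    refine Or.inr (le_antisymm hXV ?_)
    have hVY : Submodule.span k (⋃ h : H, σ h '' T) ≤ Y :=
      span_iUnion_image_le σ hY (T := T) fun x hx => (Submodule.mem_inf.1 hx).1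
    have hXZ : X ≤ Z := hXV.trans (hVY.trans hYZ)
    have hXF : X ⊓ F ≠ ⊥ := hdich X hXZ hX hX0
    have hle : X ⊓ F ≤ Y ⊓ F := inf_le_inf_right F (hXV.trans hVY)
    have h1 : Nat.find hP ≤ Module.finrank k ↥(X ⊓ F) :=
      Nat.find_min' hP ⟨X, hXZ, hX, hXF, rfl⟩
    have h2 : Module.finrank k ↥(X ⊓ F) ≤ Module.finrank k ↥(Y ⊓ F) := Submodule.finrank_mono hle
    have heq : X ⊓ F = Y ⊓ F :=
      Submodule.eq_of_le_of_finrank_eq hle (le_antisymm h2 (hYn ▸ h1))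
    -- hence `Y ⊓ F ≤ X`, and `V ≤ X` by stability of `X`
    refine span_iUnion_image_le σ hX (T := T) fun x hx => ?_
    have : x ∈ X ⊓ F := heq ▸ hx
    exact (Submodule.mem_inf.1 this).1

end Irreducible

/-! ### Images of irreducible stable subspaces under commuting endomorphisms -/

section Image

variable {k H W : Type*} [Field k] [Group H] [AddCommGroup W] [Module k W]
  (σ : Representation k H W)

/-- The image of an `H`-stable subspace under an endomorphism commuting with `H` is `H`-stable. [folklore] -/
theorem map_stable_of_comm {V : Submodule k W} (hV : ∀ h : H, ∀ v ∈ V, σ h v ∈ V)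
    (T : W →ₗ[k] W) (hT : ∀ (h : H) (w : W), T (σ h w) = σ h (T w)) :
    ∀ h : H, ∀ v ∈ V.map T, σ h v ∈ V.map T := by
  rintro h _ ⟨v, hv, rfl⟩
  exact ⟨σ h v, hV h v hv, hT h v⟩

/-- **Images of irreducibles.** If `V` is an `H`-stable subspace whose only `H`-stable subspaces
are `⊥` and `V`, and `T` is an endomorphism of `W` commuting with `σ(H)`, then the only
`H`-stable subspaces of `T(V)` are `⊥` and `T(V)` (pull back `X` to `V ∩ T⁻¹ X`). In particular
`T(V)` is irreducible as soon as it is non-zero (Schur-type statement; Bump (1997), proof of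
Prop. 3.4.1: the isomorphism class of the simple factor does not change along `H₂`-translates). [folklore] -/
theorem map_stable_irreducible_of_comm {V : Submodule k W} (hV : ∀ h : H, ∀ v ∈ V, σ h v ∈ V)
    (hirr : ∀ X : Submodule k W, X ≤ V → (∀ h : H, ∀ x ∈ X, σ h x ∈ X) → X = ⊥ ∨ X = V)
    (T : W →ₗ[k] W) (hT : ∀ (h : H) (w : W), T (σ h w) = σ h (T w)) :
    ∀ X : Submodule k W, X ≤ V.map T → (∀ h : H, ∀ x ∈ X, σ h x ∈ X) →
      X = ⊥ ∨ X = V.map T := by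
  intro X hXV hX
  set X' : Submodule k W := V ⊓ X.comap T with hX'
  have hX'st : ∀ h : H, ∀ x ∈ X', σ h x ∈ X' := by
    intro h x hx
    obtain ⟨hxV, hxT⟩ := Submodule.mem_inf.1 hx
    refine Submodule.mem_inf.2 ⟨hV h x hxV, ?_⟩
    rw [Submodule.mem_comap] at hxT ⊢
    rw [hT]
    exact hX h _ hxT
  rcases hirr X' inf_le_left hX'st with h0 | h1
  · refine Or.inl ?_
    rw [eq_bot_iff]
    intro x hx
    obtain ⟨v, hv, rfl⟩ := hXV hx
    have hvX' : v ∈ X' := Submodule.mem_inf.2 ⟨hv, hx⟩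
    rw [h0, Submodule.mem_bot] at hvX'
    rw [hvX', map_zero]
    exact Submodule.zero_mem _
  · refine Or.inr (le_antisymm hXV ?_)
    rintro _ ⟨v, hv, rfl⟩
    have hvX' : v ∈ X' := h1 ▸ hv
    exact (Submodule.mem_inf.1 hvX').2

end Image

end Literature.NumberTheory.Automorphic
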